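import Summits.Ventures.PercRepro.C041RelaxedBilinear
import Summits.Ventures.PercRepro.C041RelaxedD1Pairs

/-!
# THEOREM (RELAXED D1): (P) at two hanging zones implies (P) at the core `D1` that carries them (p6, gen 38; P6-TWOEXIT-LEAN.md §50)

The block map `thetaD1` of `C041BlockMapCoresPure` (the closed form of the two-exit core, a kernel identity) is bilinear
(`thetaD1_eq_vec`, an explicit bilinear form per coordinate), and (P) holds at its output for every pair of generators of the
relaxed domain (`K4v_thetaD1_base`: the apex, the rays and the four extreme curves — the curve pairs by the certified
polynomials of `C041RelaxedD1Cases`, the rest by the sign of their coefficients); the convexity route of `C041RelaxedBilinear`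
(mine-3's argument for the triangle, abstracted) then gives **`K4v_thetaD1_of_rel`**: `Rel w → Rel w′ → K4v (thetaD1 w w′)`, hence
the ZONE O-CUBE at the output (`zoneOCube_thetaD1_of_rel`) and (P) for two cone inputs (`K4v_thetaD1_of_inCone`).
Generated by lean-drafts/p6/g38/genmod.py; the closed form is used only through its definition.
-/

namespace PercRepro

namespace RelaxedCores

open TreeClosure RelaxedTriangle ZoneZ.MultiExit

/-- **The generator pairs**: (P) at the output of `thetaD1` for every pair of generators of the relaxed domain. -/
theorem K4v_thetaD1_base {e e' : Vec6} (h : Base e) (h' : Base e') : K4v (thetaD1 e e') := by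
  cases h with
  | one =>
    cases h' with
    | one => exact K4v_thetaD1_one_one 
    | rayT1 => exact K4v_thetaD1_one_eT1 
    | rayT2 => exact K4v_thetaD1_one_eT2 
    | f1 q hq => exact K4v_thetaD1_one_F1 q hq
    | f2 q hq => exact K4v_thetaD1_one_F2 q hq
    | f2m q hq => exact K4v_thetaD1_one_F2m q hq
    | f3 q hq => exact K4v_thetaD1_one_F3 q hq
  | rayT1 =>
    cases h' with
    | one => rw [thetaD1_comm]; exact K4v_thetaD1_one_eT1 
    | rayT1 => exact K4v_thetaD1_eT1_eT1 
    | rayT2 => exact K4v_thetaD1_eT1_eT2 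
    | f1 q hq => exact K4v_thetaD1_eT1_F1 q hq
    | f2 q hq => exact K4v_thetaD1_eT1_F2 q hq
    | f2m q hq => exact K4v_thetaD1_eT1_F2m q hq
    | f3 q hq => exact K4v_thetaD1_eT1_F3 q hq
  | rayT2 =>
    cases h' with
    | one => rw [thetaD1_comm]; exact K4v_thetaD1_one_eT2 
    | rayT1 => rw [thetaD1_comm]; exact K4v_thetaD1_eT1_eT2 
    | rayT2 => exact K4v_thetaD1_eT2_eT2 
    | f1 q hq => exact K4v_thetaD1_eT2_F1 q hq
    | f2 q hq => exact K4v_thetaD1_eT2_F2 q hq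
    | f2m q hq => exact K4v_thetaD1_eT2_F2m q hq
    | f3 q hq => exact K4v_thetaD1_eT2_F3 q hq
  | f1 p hp =>
    cases h' with
    | one => rw [thetaD1_comm]; exact K4v_thetaD1_one_F1 p hp
    | rayT1 => rw [thetaD1_comm]; exact K4v_thetaD1_eT1_F1 p hp
    | rayT2 => rw [thetaD1_comm]; exact K4v_thetaD1_eT2_F1 p hp
    | f1 q hq => exact K4v_thetaD1_F1_F1 p q hp hq
    | f2 q hq => exact K4v_thetaD1_F1_F2 p q hp hq
    | f2m q hq => exact K4v_thetaD1_F1_F2m p q hp hq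
    | f3 q hq => exact K4v_thetaD1_F1_F3 p q hp hq
  | f2 p hp =>
    cases h' with
    | one => rw [thetaD1_comm]; exact K4v_thetaD1_one_F2 p hp
    | rayT1 => rw [thetaD1_comm]; exact K4v_thetaD1_eT1_F2 p hp
    | rayT2 => rw [thetaD1_comm]; exact K4v_thetaD1_eT2_F2 p hp
    | f1 q hq => rw [thetaD1_comm]; exact K4v_thetaD1_F1_F2 q p hq hp
    | f2 q hq => exact K4v_thetaD1_F2_F2 p q hp hq
    | f2m q hq => exact K4v_thetaD1_F2_F2m p q hp hq
    | f3 q hq => exact K4v_thetaD1_F2_F3 p q hp hq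
  | f2m p hp =>
    cases h' with
    | one => rw [thetaD1_comm]; exact K4v_thetaD1_one_F2m p hp
    | rayT1 => rw [thetaD1_comm]; exact K4v_thetaD1_eT1_F2m p hp
    | rayT2 => rw [thetaD1_comm]; exact K4v_thetaD1_eT2_F2m p hp
    | f1 q hq => rw [thetaD1_comm]; exact K4v_thetaD1_F1_F2m q p hq hp
    | f2 q hq => rw [thetaD1_comm]; exact K4v_thetaD1_F2_F2m q p hq hp
    | f2m q hq => exact K4v_thetaD1_F2m_F2m p q hp hq
    | f3 q hq => exact K4v_thetaD1_F2m_F3 p q hp hq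
  | f3 p hp =>
    cases h' with
    | one => rw [thetaD1_comm]; exact K4v_thetaD1_one_F3 p hp
    | rayT1 => rw [thetaD1_comm]; exact K4v_thetaD1_eT1_F3 p hp
    | rayT2 => rw [thetaD1_comm]; exact K4v_thetaD1_eT2_F3 p hp
    | f1 q hq => rw [thetaD1_comm]; exact K4v_thetaD1_F1_F3 q p hq hp
    | f2 q hq => rw [thetaD1_comm]; exact K4v_thetaD1_F2_F3 q p hq hp
    | f2m q hq => rw [thetaD1_comm]; exact K4v_thetaD1_F2m_F3 q p hq hp
    | f3 q hq => exact K4v_thetaD1_F3_F3 p q hp hq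

/-- **THEOREM (RELAXED D1)**: if the two hanging zones satisfy (P) and the trivial bounds, the core `D1` carrying them satisfies (P). -/
theorem K4v_thetaD1_of_rel {w w' : Vec6} (hw : Rel w) (hw' : Rel w') : K4v (thetaD1 w w') :=
  K4v_of_rel thetaD1_add_left thetaD1_smul_left thetaD1_add_right thetaD1_smul_right (fun _ _ h h' => K4v_thetaD1_base h h') hw hw'

/-- The ZONE O-CUBE `2F ≤ T₁ + T₂ + 2I` at the output of `thetaD1` with two relaxed zones. -/
theorem zoneOCube_thetaD1_of_rel {w w' : Vec6} (hw : Rel w) (hw' : Rel w') :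
    0 ≤ (thetaD1 w w' 1 - thetaD1 w w' 0) + (thetaD1 w w' 2 - thetaD1 w w' 0)
      + 2 * (thetaD1 w w' 4 + thetaD1 w w' 5 - thetaD1 w w' 3) - 2 * thetaD1 w w' 0 :=
  zoneOCube_of_rel thetaD1_add_left thetaD1_smul_left thetaD1_add_right thetaD1_smul_right (fun _ _ h h' => K4v_thetaD1_base h h') hw hw'

/-- **COROLLARY (D1, cone inputs)**: the core with two cone members at its exits satisfies (P). -/
theorem K4v_thetaD1_of_inCone {w w' : Vec6} (hw : InCone w) (hw' : InCone w') : K4v (thetaD1 w w') :=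
  K4v_of_inCone thetaD1_add_left thetaD1_smul_left thetaD1_add_right thetaD1_smul_right (fun _ _ h h' => K4v_thetaD1_base h h') hw hw'

end RelaxedCores

end PercRepro
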